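/-
Copyright (c) 2026 the pub-hodgecm-mathlib formalisation cell (harness21).  Prover seat hodgecm-mathlib-K2E4-p10 (g6), Track B ∕ K2-LIT, h413 =
`stmt-HodgeConjecture-24833`, line `K2_E1_TraceFormulaBeta`, campaign «EIS-R7-BL-SPH-2»: the `N = 2` PRINTS of ★ p859395 (`hreg`) and ★ p859418 (`hres`) on the Bernstein–Lapid road
(`ρ₀ = 1`, window `{½ < Re z}`) — dealer K2E1-plan (g6) (82)(ii), 2026-09-04T10:37:07Z.
-/
import Summits.HodgeConjecture.HodgeConjecture.Theorems.K2E1SphericalEisensteinResidueConstantCMThreeOfLetters   -- ★ p859418 (this seat): generic §1–§3 (`exists_regular_remainder_of_letters`, `eq_smul_const_of_mem_orthogonal_of_sub_mem`, `value_eq_of_repr_of_tendsto`, …); brings ★ p859395, ★ SoftUCM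
import HarnessLib

/-!
# K2·E1 — `K2E1SphericalEisensteinRegularRemainderCMTwoOfLetters`: the `U(1,1)_{L∕L⁺}` prints of the regular-remainder and residue-is-constant payers on the Bernstein–Lapid road
# (`ρ₀ = 1`, window `{½ < Re z}`; the `N = 2` twins of ★ p859395 §4 and ★ p859418 §4 — every generic brick reused by name)

Track B ∕ K2-LIT, crux h413 = `stmt-HodgeConjecture-24833`, route of record `HCCMUnconditional`; cell `hodgecm-mathlib`, squad K2, ENGINE E1, campaign EIS-R7-BL-SPH-2.  Prover seat
`hodgecm-mathlib-K2E4-p10` (g6); DEAL (82)(ii) of the dealer K2E1-plan (g6).  THEOREMS ONLY (no `def`, no `instance`, no notation, no named-fact hypothesis, no `sorry`); lane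
`--supports stmt-HodgeConjecture-24833 --as helper` (count-neutral).  Closes no socket.

At `N = 2` the spherical Eisenstein series of `U(1,1)` has its pole at `ρ₀ = 2ρ_H = 1`, the Godement domain is `{1 < Re z}` and the Bernstein–Lapid window is `{½ < Re z}`; everything
else is the `N = 3` file with these three constants changed, the generic §§ of ★ p859395 ∕ ★ p859418 being RANK-FREE (abstract index type, parameters `U, ρ₀, P, h`).
* **`hreg_cm_two_of_letters`** — `∀ g, ∃ R, DifferentiableOn ℂ R {½ < re} ∧ ∀ z, 1 < z.re → E(φ₀H^z)(g) = φ₀·(H(g)^z + c̃(z)·H(g)^{1−z}) + R z`, modulo (E1) the continued point values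
  (meromorphic on `{½ < re}`, analytic off `P ⊆ {re ≤ 1}` and off `1`, equal to the Godement series on `{1 < re}`), (L3′) `c̃` analytic on `{½ < re} ∖ {1}`, (B) boundedness near the fake
  poles (★ p859395 §2 from the continued Hecke relation + the Maass–Selberg bound), (RES) the remainder is regular at `1`.
* **`hres_cm_two_of_letters`** — (RES) at `ρ₀ = 1` from (F) `F_g =ᶠ (z−1)·Ẽ(z)(g)` analytic at `1`, the residue CLASS letters `Fres ⊥ L²_cusp`, `Fres − (φ₀r)·𝟙 ∈ L²_cusp`, the LINK
  (`Λ_g`, `ĥ`, `V`, representation, `hsym : Λ_g 𝟙 = ĥ 1`) — with «CUSP FORMS HAVE MEAN ZERO» DISCHARGED by ★ ROAD B `integral_eq_zero_of_mem_cuspForms_cm_two` (this seat, p859288).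
HONEST LABEL: HC_CM is proved only modulo the 7 printed citations (2 remaining named inputs: hLiu418 = `stmt-HodgeConjecture-24832`, h413 = `stmt-HodgeConjecture-24833`) until rung 0
closes; this file asserts no named fact and closes no socket; both heads are CONDITIONAL on the letters named above (payers: (60) EXPORTS₂ K2E1-p08, MS-2 ∕ operator road K2E4-p11,
`hsym` K2E1-p10 (79)).  At `N = 2` the capstone itself is already ★ on the Whittaker road (`sphericalEisenstein_continuation_cm_two`); these prints serve the B–L road's whole-plane edition.
References: [MoeglinWaldspurger1995] IV.1.9–IV.1.11, IV.3.12 · [Langlands1976] §7 · [BernsteinLapid2019] Thm 2.3, §4 p. 10 · [Garrett2018] §1.12, §11.3.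
-/

set_option autoImplicit false
-- the mandated namespace repeats the single-problem summit's segment (`HodgeConjecture.HodgeConjecture`)
set_option linter.dupNamespace false

noncomputable section

open MeasureTheory Measure NumberField IsDedekindDomain Set Filter Topology ContRepresentation
open scoped ENNReal NNReal InnerProductSpace
open Literature.NumberTheory.Automorphic Literature.NumberTheory.Automorphic.UnitaryGroup AdelicGroupData
open Summit.HodgeConjecture.HodgeConjecture.Cruxes.H413.K2E1BorelEisensteinU
open Summit.HodgeConjecture.HodgeConjecture.Cruxes.H413.K2E1SphericalEisensteinRegularRemainderCMThreeOfLetters (exists_regular_remainder_of_letters)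
open Summit.HodgeConjecture.HodgeConjecture.Cruxes.H413.K2E1SphericalEisensteinResidueConstantCMThreeOfLetters
  (exists_analyticAt_eventuallyEq_remainder_of_residue eq_smul_const_of_mem_orthogonal_of_sub_mem mem_orthogonal_cuspidalSubspace_of_forall_inner_eq_zero value_eq_of_repr_of_tendsto)
open Summit.HodgeConjecture.HodgeConjecture.Cruxes.H413.K2E1CuspFormsMeanZeroSoftUCM (integral_eq_zero_of_mem_cuspForms_cm_two)

namespace Summit.HodgeConjecture.HodgeConjecture.Cruxes.H413.K2E1SphericalEisensteinRegularRemainderCMTwoOfLetters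

variable (L : Type) [Field L] [NumberField L] [IsCMField L]
variable [MeasurableSpace (quasiSplit (↥(maximalRealSubfield L)) L (IsCMField.complexConj L) 2).Adelic] [BorelSpace (quasiSplit (↥(maximalRealSubfield L)) L (IsCMField.complexConj L) 2).Adelic]

omit [MeasurableSpace (quasiSplit (↥(maximalRealSubfield L)) L (IsCMField.complexConj L) 2).Adelic] [BorelSpace (quasiSplit (↥(maximalRealSubfield L)) L (IsCMField.complexConj L) 2).Adelic] in
/-- **`hreg` FOR `U(1,1)_{L∕L⁺}` ON THE B–L ROAD, FROM THE LETTERS** (`ρ₀ = 1`, window `{½ < re}`, Godement domain `{1 < re}`; the `N = 2` twin of ★ `hreg_cm_three_of_letters`, same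
generic engine ★ `exists_regular_remainder_of_letters`).  LETTERS: (E1) `hEmer hEan hEeq` + `hP2 : P ⊆ {re ≤ 1}`; (L3′) `hcan`; (B) `hbdd`; (RES) `hres`.
[cite: MoeglinWaldspurger1995, IV.3.12] [cite: BernsteinLapid2019, §4 p. 10] -/
theorem hreg_cm_two_of_letters (φ₀ : ℂ) (cc : ℂ → ℂ) (hcan : ∀ z₀ : ℂ, 1 / 2 < z₀.re → z₀ ≠ 1 → AnalyticAt ℂ cc z₀)
    (Ec : ℂ → (quasiSplit (↥(maximalRealSubfield L)) L (IsCMField.complexConj L) 2).Adelic → ℂ) (P : Set ℂ) (hP2 : ∀ z ∈ P, z.re ≤ 1)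
    (hEmer : ∀ g, ∀ z₀ : ℂ, 1 / 2 < z₀.re → MeromorphicAt (fun z => Ec z g) z₀)
    (hEan : ∀ g, ∀ z₀ : ℂ, 1 / 2 < z₀.re → z₀ ∉ P → z₀ ≠ 1 → AnalyticAt ℂ (fun z => Ec z g) z₀)
    (hEeq : ∀ g, ∀ z : ℂ, 1 < z.re → Ec z g = eisensteinSeriesU (flatSectionU (fun _ : (quasiSplit (↥(maximalRealSubfield L)) L (IsCMField.complexConj L) 2).Adelic => φ₀) z) g)
    (hbdd : ∀ g, ∀ z₀ : ℂ, 1 / 2 < z₀.re → z₀ ∈ P → z₀ ≠ 1 → ∃ C : ℝ, ∀ᶠ z in 𝓝[≠] z₀, ‖Ec z g‖ ≤ C)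
    (hres : ∀ g, ∃ G : ℂ → ℂ, AnalyticAt ℂ G 1 ∧ G =ᶠ[𝓝[≠] 1] (fun z => Ec z g -
      φ₀ * ((((borelHeight g : ℝ≥0) : ℝ) : ℂ) ^ z + cc z * (((borelHeight g : ℝ≥0) : ℝ) : ℂ) ^ ((1 : ℂ) - z)))) :
    ∀ g : (quasiSplit (↥(maximalRealSubfield L)) L (IsCMField.complexConj L) 2).Adelic, ∃ R : ℂ → ℂ, DifferentiableOn ℂ R {z : ℂ | 1 / 2 < z.re} ∧
      ∀ z : ℂ, 1 < z.re → eisensteinSeriesU (flatSectionU (fun _ : (quasiSplit (↥(maximalRealSubfield L)) L (IsCMField.complexConj L) 2).Adelic => φ₀) z) g =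
        φ₀ * ((((borelHeight g : ℝ≥0) : ℝ) : ℂ) ^ z + cc z * (((borelHeight g : ℝ≥0) : ℝ) : ℂ) ^ ((1 : ℂ) - z)) + R z := by
  have hmain := exists_regular_remainder_of_letters (A := (quasiSplit (↥(maximalRealSubfield L)) L (IsCMField.complexConj L) 2).Adelic) (U := {z : ℂ | 1 / 2 < z.re}) (P := P)
    (ρ₀ := 1) φ₀ (Ec := Ec) (cc := cc) (h := fun g => ((borelHeight g : ℝ≥0) : ℝ)) (fun g => NNReal.coe_pos.2 (borelHeight_pos g))
    (fun g z₀ hz₀ => hEmer g z₀ hz₀) (fun g z₀ hz₀ hP hne => hEan g z₀ hz₀ hP hne) (fun z₀ hz₀ hne => hcan z₀ hz₀ hne)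
    (fun g z₀ hz₀ hP hne => hbdd g z₀ hz₀ hP hne) hres
  intro g
  obtain ⟨R, hR, hRE⟩ := hmain g
  refine ⟨R, hR, fun z hz => ?_⟩
  have hzU : z ∈ {z : ℂ | 1 / 2 < z.re} := by
    show (1 : ℝ) / 2 < z.re
    linarith
  have hzP : z ∉ P := fun h => by linarith [hP2 z h]
  have hz1 : z ≠ 1 := by
    rintro rfl
    norm_num at hz
  rw [← hEeq g z hz]
  exact hRE z hzU hzP hz1

/-- **(RES) FOR `U(1,1)_{L∕L⁺}` — THE RESIDUE AT `z = 1` IS THE CONSTANT `φ₀·r`** (the `N = 2` twin of ★ `hres_cm_three_of_letters`, `ρ₀ = 1`; «cusp forms have mean zero» ★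
`integral_eq_zero_of_mem_cuspForms_cm_two`, ROAD B).  LETTERS: (L3) `hchol hcres` on `{½ < re}`; (F) `hF hFE`; CLASS `horth hcusp`; LINK `hlink` (with `hsym : Λ 𝟙 = a 1`, i.e. `∫ h = ĥ(0) = ĥ(1)`).
[cite: Langlands1976, §7] [cite: MoeglinWaldspurger1995, IV.1.11] [cite: BernsteinLapid2019, §4 p. 10] -/
theorem hres_cm_two_of_letters
    (μ : Measure (quasiSplit (↥(maximalRealSubfield L)) L (IsCMField.complexConj L) 2).automorphicQuotient) [(quasiSplit (↥(maximalRealSubfield L)) L (IsCMField.complexConj L) 2).IsAutomorphicMeasure μ]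
    (𝔓 : (quasiSplit (↥(maximalRealSubfield L)) L (IsCMField.complexConj L) 2).ParabolicUnipotentData) (i : 𝔓.ι)
    (h𝔓 : 𝔓.radical i = adelicUnipotent (↥(maximalRealSubfield L)) L (IsCMField.complexConj L) 2)
    (φ₀ : ℂ) {cc : ℂ → ℂ} {r : ℂ} (hchol : DifferentiableOn ℂ cc ({z : ℂ | 1 / 2 < z.re} \ {1})) (hcres : Tendsto (fun z : ℂ => (z - 1) * cc z) (𝓝[≠] 1) (𝓝 r))
    (Ec : ℂ → (quasiSplit (↥(maximalRealSubfield L)) L (IsCMField.complexConj L) 2).Adelic → ℂ)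
    (F : (quasiSplit (↥(maximalRealSubfield L)) L (IsCMField.complexConj L) 2).Adelic → ℂ → ℂ) (hF : ∀ g, AnalyticAt ℂ (F g) 1)
    (hFE : ∀ g, F g =ᶠ[𝓝[≠] 1] fun z => (z - 1) * Ec z g)
    (Fres : (quasiSplit (↥(maximalRealSubfield L)) L (IsCMField.complexConj L) 2).L2 μ)
    (horth : ∀ φ : ↥((quasiSplit (↥(maximalRealSubfield L)) L (IsCMField.complexConj L) 2).cuspForms μ 𝔓),
      ⟪Fres, (quasiSplit (↥(maximalRealSubfield L)) L (IsCMField.complexConj L) 2).cuspFormsToLp μ 𝔓 φ⟫_ℂ = 0)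
    (hcusp : Fres - (φ₀ * r) • (Lp.const 2 μ (1 : ℂ) : (quasiSplit (↥(maximalRealSubfield L)) L (IsCMField.complexConj L) 2).L2 μ) ∈
      ((quasiSplit (↥(maximalRealSubfield L)) L (IsCMField.complexConj L) 2).cuspidalSubspace μ 𝔓).toSubmodule)
    (hlink : ∀ g : (quasiSplit (↥(maximalRealSubfield L)) L (IsCMField.complexConj L) 2).Adelic,
      ∃ (Λ : (quasiSplit (↥(maximalRealSubfield L)) L (IsCMField.complexConj L) 2).L2 μ →L[ℂ] ℂ) (a : ℂ → ℂ)
        (V : ℂ → (quasiSplit (↥(maximalRealSubfield L)) L (IsCMField.complexConj L) 2).L2 μ),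
        ContinuousAt a 1 ∧ a 1 ≠ 0 ∧ Tendsto V (𝓝[≠] 1) (𝓝 Fres) ∧ (∀ᶠ z in 𝓝[≠] (1 : ℂ), a z * F g z = Λ (V z)) ∧
          Λ (Lp.const 2 μ (1 : ℂ) : (quasiSplit (↥(maximalRealSubfield L)) L (IsCMField.complexConj L) 2).L2 μ) = a 1) :
    ∀ g : (quasiSplit (↥(maximalRealSubfield L)) L (IsCMField.complexConj L) 2).Adelic, ∃ G : ℂ → ℂ, AnalyticAt ℂ G 1 ∧ G =ᶠ[𝓝[≠] 1] (fun z => Ec z g -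
      φ₀ * ((((borelHeight g : ℝ≥0) : ℝ) : ℂ) ^ z + cc z * (((borelHeight g : ℝ≥0) : ℝ) : ℂ) ^ ((1 : ℂ) - z))) := by
  have hmean := integral_eq_zero_of_mem_cuspForms_cm_two L μ 𝔓 i h𝔓
  have hres_class : Fres = (φ₀ * r) • (Lp.const 2 μ (1 : ℂ) : (quasiSplit (↥(maximalRealSubfield L)) L (IsCMField.complexConj L) 2).L2 μ) :=
    eq_smul_const_of_mem_orthogonal_of_sub_mem _ μ 𝔓 hmean (mem_orthogonal_cuspidalSubspace_of_forall_inner_eq_zero _ μ 𝔓 Fres horth) hcusp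
  have hU : {z : ℂ | 1 / 2 < z.re} ∈ 𝓝 (1 : ℂ) := (isOpen_lt continuous_const Complex.continuous_re).mem_nhds (by show (1 : ℝ) / 2 < (1 : ℂ).re; norm_num)
  intro g
  obtain ⟨Λ, a, V, ha, ha0, hV, hrepr, hsym⟩ := hlink g
  have hval : F g 1 = φ₀ * r := value_eq_of_repr_of_tendsto Λ ha ha0 (hF g).continuousAt hV hrepr hres_class hsym
  exact exists_analyticAt_eventuallyEq_remainder_of_residue φ₀ (NNReal.coe_pos.2 (borelHeight_pos g)) (hF g) (hFE g) hval hU hchol hcres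

end Summit.HodgeConjecture.HodgeConjecture.Cruxes.H413.K2E1SphericalEisensteinRegularRemainderCMTwoOfLetters

end
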